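import Literature.NumberTheory.LFunctions.ConreyIwaniec2002Prop64OfTwo
import Literature.NumberTheory.LFunctions.ConreyIwaniec2002Thm61ShiftedSum
import HarnessLib

/-!
# Conrey–Iwaniec (2002), Proposition 6.4 from Theorems 4.3–4.4 alone

B. Conrey, H. Iwaniec, Acta Arith. 103 (2002) 259–312, Proposition 6.4 [held text
`paper:arxiv-math_0111012`, p0014–p0017]. With the shifted-sum evaluation (6.27)–(6.28) now a tree
theorem (`exists_thm61ShiftedSum`, stub S2b of SKELETON P64, line `thm61-cm-convolution`, cell
`landau-siegel/ls-inputs`) the typed `conreyIwaniec2002_proposition64` follows from the single remaining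
registered stub statement S3: the shifted-convolution asymptotics of Theorems 4.3–4.4 for the class-group
forms of `ℚ(√−q)` (line `theta-circle-method`, SKELETON S3). Every other step of §§5–6 (S1 kernel,
S2a (6.4)–(6.12), S2b (6.27)–(6.28), S2c (6.29)–(6.31) + Cor. 6.2, S4 diagonal, S5 off-diagonal,
S6 absorption) is a kernel theorem. No claim about Landau–Siegel zeros.

## References
* [ConreyIwaniec2002] B. Conrey, H. Iwaniec, Acta Arith. 103 (2002) 259–312: Proposition 6.4 (6.52),
  Theorems 4.3–4.4 (4.25)–(4.26).
-/

noncomputable section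

open scoped NumberField
open Complex MeasureTheory

namespace Literature.NumberTheory.LFunctions

namespace ConreyIwaniec2002

open NumberField Literature.NumberTheory.LFunctions.NumberField

/-- **Proposition 6.4 from S3 alone** (S1, S2a, S2b, S2c, S4, S5, S6 are tree theorems): the typed
`conreyIwaniec2002_proposition64` follows from Theorems 4.3/4.4 for `λ_ψ` (the registered S3
statement, verbatim). [cite: ConreyIwaniec2002, Proposition 6.4 (6.52)] -/
theorem proposition64_of_shiftedConvolution
    (h3 :
      ∃ c : ℝ, 0 < c ∧
        ∀ (q : ℕ) [NeZero q], 4 < q → Odd q → ∀ χ : DirichletCharacter ℂ q,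
          χ.IsPrimitive → χ.IsQuadratic → χ.Odd →
            ∀ (K : Type) [Field K] [NumberField K],
              Module.finrank ℚ K = 2 → NumberField.discr K = -(q : ℤ) →
                ∀ (ψ : ClassGroup (𝓞 K) →* ℂˣ),
                  ∃ σ : ℕ → ℝ, IsCISigma q ‖χ.LFunction 1‖ σ ∧
                    ShiftedConvolutionBound (twistCount K (classGroupCharIdealHom ψ)) σ
                      (c * (q : ℝ) ^ (6 : ℕ))) :
    conreyIwaniec2002_proposition64 :=
  proposition64_of_shiftedSum_and_shiftedConvolution exists_thm61ShiftedSum h3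

end ConreyIwaniec2002

end Literature.NumberTheory.LFunctions

end
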